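/-
Copyright (c) 2026 the pub-hodgecm-mathlib formalisation cell (harness21).  Prover seat hodgecm-mathlib-R90-C10-p08 (g2), SLAB R90-TF, section S1 «Ch. 10∕12 local»;
crux H413 = `stmt-HodgeConjecture-24833`; line (D-1) «B_pos» of U4Keys :182 ∕ (S-RT), card (a′) = R-S1-25 (R90-C10-plan (g3)), FILE 2: the (R-a) level-one sphere fibre values
that discharge ★ p864421's ratio letter `hAB`.  KERNEL module: THEOREMS ONLY (no definition, no named fact, no `sorry`, no instance, no notation).  2026-09-05.
-/
import Summits.HodgeConjecture.HodgeConjecture.Theorems.R90S1BposRamGaussSphereInner         -- (6a) PART 2 (R90-C10-p04 (g2)): transport `S₁ → C`, inner integrals `−ν(𝔪⁺)` ∕ `ν(C)`; brings PART 1, ★ tool p864287, ★ (5a) p864139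
import Literature.NumberTheory.Automorphic.HeisenbergLevelTwoChartRamified                   -- ★ `measure_setOf_skew_valued_le_exp_neg_two_of_ramified` (the tame-ramified ball ratio on `R⁻`)
import Summits.HodgeConjecture.HodgeConjecture.Theorems.R90S1BposRamShellMeasurability        -- ★ p864304 (this seat): `isCompact_setOf_valued_le_exp_any` (compact balls of `R`, any place)
import HarnessLib

/-!
# R90-TF S1 «Ch10-local» ∕ U4Keys :182, BRANCH B, POSITIVE DEPTH, TAME RAMIFIED, SUB-BRANCH (R-a) — FILE (a′)-2: THE LEVEL-ONE SPHERE FIBRE UNDER `hfix`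
# «`Φ(a) := ∫_{|s_w| = e⁻¹} Ē(a − s) dμ⁻ = Ē(−δ)·ν(C)` at deep `a`, `= −Ē(−δ)·ν(𝔪⁺)` at critical `a`, and `ν(C) = (N𝔭_w − 1)·ν(𝔪⁺)`» ⟹ the (R-a) RATIO `Φdeep + Φcrit·(N𝔭_w − 1) = 0` [Keys1984 §7 Thm (2)]

Cell `pub/hodgecm-mathlib`, crux H413 = `stmt-HodgeConjecture-24833`, route `HCCMUnconditional`; S1 card (a′) (R-S1-25), second file.  THEOREMS ONLY; `--supports
stmt-HodgeConjecture-24833 --as helper`, count-neutral; NOT THE PAYER of :182.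
WHAT.  In the sub-branch (R-a) of the tame ramified corner (`hfix`: `χ₁ = 1` on every `σ`-fixed unit of valuation one = `¬hFε`), the level-one sphere fibre of the Casselman integrand,
`Φ(a) := ∫_{s ∈ R⁻, |s_w| = exp(−1)} Ē(a − s) dμ⁻(s)` (`Ē r = χ₁(r̂)⁻¹`, R90-C10-p04 (g2)'s (6a) currency), is NOT zero: transporting to the fixed units `C` (PART 2 §1:
`Φ(a) = Ē(−δ)·∫_C Ē(c)·Ē(1 + u c⁻¹) dν`, `u = −aδ⁻¹`), `hfix` kills `Ē(c)`, inversion invariance on `C` (★ p864287 `setIntegral_fixedUnits_eq_of_forall_eq_inv`) turns `c⁻¹` into `c`,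
and PART 2's inner integrals give `∫_C Ē(1 + uc) dν = ν(C)` at DEEP level (`|u_w| ≤ |ϖ|^(m+2)`, conductor `|ϖ|^(m+1)`) and `= −ν(𝔪⁺)` at the CRITICAL level (`|u_w| = |ϖ|^m`, sharp
witness `u₁`).  With the tame-ramified ball ratio on `R⁻` (★ `measure_setOf_skew_valued_le_exp_neg_two_of_ramified`: `ν(𝔪⁺) = μ⁻{|y| < e⁻¹} = (N𝔭)⁻¹μ⁻{|y| ≤ 1}`,
`ν(C) = μ⁻{|y| = e⁻¹} = (1 − (N𝔭)⁻¹)μ⁻{|y| ≤ 1}`) this is PAPER P-ram-1 §2 (R-a) (`R90/R90-C10-p08/g2/PAPER-Pram1-GaussSumEntries.md` 1fba7ee70e95cdc9; p01 (g3) cross §2):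
`T = (1 − q⁻¹)𝟙[deep] − q⁻¹𝟙[critical]`, i.e. **`Φdeep + Φcrit·(N𝔭_w − 1) = 0`** — the letter `hAB` of ★ p864421 `setIntegral_oddShell_cutoff_eq_zero_of_fibre_ratio` once the
(6e) rows (R90-C10-p07 (g2)) scale both values by the same `X^{κ+1}q^{−(κ+1)}·q`.
* §1 **`setIntegral_sphere_diteInv_sub_eq_fixedUnits_of_fix`** — `Φ(a) = Ē(−δ)·∫_C Ē(1 + u·c) dν` under `hfix` (any `a`).
* §2 **`sphere_diteInv_sub_eq_of_fix_deep`** (`|a_w| ≤ |ϖ|^(m+2)` ⟹ `Φ(a) = Ē(−δ)·ν(C)`), **`sphere_diteInv_sub_eq_of_fix_crit`** (`σa = a`, `|a_w| = |ϖ|^(m+1)` ⟹ `Φ(a) = −Ē(−δ)·ν(𝔪⁺)`).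
* §3 **`measureReal_fixedUnits_eq_mul_of_ramified`** (`ν(C) = (N𝔭_w − 1)·ν(𝔪⁺)`) and **`sphere_fix_ratio`** (`Φdeep + Φcrit·(N𝔭_w − 1) = 0`).
HONEST LABEL.  HC_CM is proved only modulo the 7 printed citations (2 remaining named inputs: hLiu418 = `stmt-HodgeConjecture-24832`, h413 = `stmt-HodgeConjecture-24833`) until rung 0
closes; count-neutral — pays NO socket (:182, (S-RT), A2′ OPEN); no printed citation discharged; wild corner (`v ∣ 2`) not addressed.

## References
* [Keys1984] D. Keys, *Principal series representations of special unitary groups over local fields*, Compositio Math. 51 (1984), §4–§5, §7 Theorem (2) p. 126.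
* [WeilBNT1967] A. Weil, *Basic Number Theory* (1967), Ch. I §2–§4, Ch. II §5.
* [Rogawski1990] J. D. Rogawski, *Automorphic Representations of Unitary Groups in Three Variables*, Ann. of Math. Stud. 123 (1990), §12.2 (2) p. 173.
-/

set_option autoImplicit false
set_option linter.dupNamespace false  -- the mandated namespace has the single-problem summit's repeated segment (`HodgeConjecture.HodgeConjecture`)

noncomputable section

open NumberField IsDedekindDomain MeasureTheory Measure Topology Set
open scoped NNReal ENNReal
open Literature.NumberTheory Literature.NumberTheory.Automorphic Literature.NumberTheory.Automorphic.UnitaryGroup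

namespace Summit.HodgeConjecture.HodgeConjecture.R90.S1.BposRamSphereFibreRa

open Summit.HodgeConjecture.HodgeConjecture.Cruxes.H413
open Summit.HodgeConjecture.HodgeConjecture.Cruxes.H413.K2E3BranchBSkewUnitSign
open Summit.HodgeConjecture.HodgeConjecture.Cruxes.H413.K2E3BranchBSkewLineIntegrals
open Summit.HodgeConjecture.HodgeConjecture.R90.S1.BposRamFixedUnitsHaar
open Summit.HodgeConjecture.HodgeConjecture.R90.S1.BposRamSkewSphereByFixedUnits
open Summit.HodgeConjecture.HodgeConjecture.R90.S1.BposRamGaussSphereInner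
open Summit.HodgeConjecture.HodgeConjecture.R90.S1.BposRamShellMeasurability

variable (L : Type) [Field L] [NumberField L] [IsCMField L] (v : HeightOneSpectrum (𝓞 ↥(maximalRealSubfield L)))
  (w : PlacesOver L v) (hw : IsCMField.complexConj L • w.1 = w.1)

variable [MeasurableSpace (LocalRing L v)] [BorelSpace (LocalRing L v)]
  (μY : Measure ↥(HeisRing.skewPart (conjLocal L (IsCMField.complexConj L) v))) [μY.IsAddHaarMeasure] [μY.Regular]
  (χ₁ : (LocalRing L v)ˣ →* ℂˣ)
  (δ : (LocalRing L v)ˣ) (hδ : conjLocal L (IsCMField.complexConj L) v (δ : LocalRing L v) = -(δ : LocalRing L v)) (hδv : Valued.v ((δ : LocalRing L v) w) = WithZero.exp (-1 : ℤ))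

/-! ## §1 Under `hfix` the transported fibre is `Ē(−δ)·∫_C Ē(1 + u·c) dν` -/

open scoped Classical in
include hw hδv in
/-- **`Φ(a) = Ē(−δ)·∫_C Ē(1 + u·c) dν(c)`**, `u := −(a·δ⁻¹)`, `ν := μ⁻.map M⁻¹`, for EVERY `a ∈ R`, when `χ₁` is continuous and trivial on the `σ`-fixed units of valuation one (`hfix`,
the sub-branch (R-a)): PART 2 §1 transports `Φ(a) = Ē(−δ)·∫_C Ē(c)·Ē(1 + u c⁻¹) dν`; `Ē(c) = 1` on `C` by `hfix`; inversion invariance ★ `setIntegral_fixedUnits_eq_of_forall_eq_inv`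
(`g = Ē(1 + u·)` is Borel ★ `measurable_dite_isUnit` and bounded by `1` on `C` ★ `norm_dite_apply_le_one`, `|1 + uc|_w = 1`). [cite: Keys1984, §4–§5] [cite: WeilBNT1967, Ch. II §5] -/
theorem setIntegral_sphere_diteInv_sub_eq_fixedUnits_of_fix (h₁ : Continuous fun x => ((χ₁ x : ℂˣ) : ℂ))
    (hfix : ∀ u : (LocalRing L v)ˣ, (∀ w' : PlacesOver L v, Valued.v ((u : LocalRing L v) w') = 1) →
      conjLocal L (IsCMField.complexConj L) v (u : LocalRing L v) = u → χ₁ u = 1)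
    (a : LocalRing L v) (hua : Valued.v ((-(a * ((δ⁻¹ : (LocalRing L v)ˣ) : LocalRing L v))) w) < 1) :
    ∫ s in {s : ↥(HeisRing.skewPart (conjLocal L (IsCMField.complexConj L) v)) | Valued.v ((s : LocalRing L v) w) = WithZero.exp (-1 : ℤ)},
        (fun r : LocalRing L v => if h : IsUnit r then (((χ₁ h.unit)⁻¹ : ℂˣ) : ℂ) else 0) (a - (s : LocalRing L v)) ∂μY =
      (((χ₁ (-δ))⁻¹ : ℂˣ) : ℂ) *
        ∫ c in {c : ↥(HeisRing.fixedPart (conjLocal L (IsCMField.complexConj L) v)) | Valued.v ((c : LocalRing L v) w) = 1},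
          (fun r : LocalRing L v => if h : IsUnit r then (((χ₁ h.unit)⁻¹ : ℂˣ) : ℂ) else 0)
            (1 + -(a * ((δ⁻¹ : (LocalRing L v)ˣ) : LocalRing L v)) * (c : LocalRing L v))
          ∂(μY.map (HeisRing.mulSkewUnit (conjLocal L (IsCMField.complexConj L) v) δ hδ).symm) := by
  rw [setIntegral_sphere_diteInv_sub_eq L v w hw μY χ₁ δ hδ hδv a]
  congr 1
  set u : LocalRing L v := -(a * ((δ⁻¹ : (LocalRing L v)ˣ) : LocalRing L v)) with hudef
  set ν := μY.map (HeisRing.mulSkewUnit (conjLocal L (IsCMField.complexConj L) v) δ hδ).symm with hν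
  haveI : ν.IsAddHaarMeasure := isAddHaarMeasure_map_mulSkewUnit_symm L v μY δ hδ
  haveI : ν.Regular := regular_map_mulSkewUnit_symm L v μY δ hδ
  set E : LocalRing L v → ℂ := fun r : LocalRing L v => if h : IsUnit r then (((χ₁ h.unit)⁻¹ : ℂˣ) : ℂ) else 0 with hEdef
  have hCm : MeasurableSet {c : ↥(HeisRing.fixedPart (conjLocal L (IsCMField.complexConj L) v)) | Valued.v ((c : LocalRing L v) w) = 1} :=
    (measurableSet_fixedUnits L v w).1
  -- `Ē(c) = 1` on `C` by `hfix`
  have hEc : ∀ c ∈ {c : ↥(HeisRing.fixedPart (conjLocal L (IsCMField.complexConj L) v)) | Valued.v ((c : LocalRing L v) w) = 1},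
      E (c : LocalRing L v) * E (1 + u * ((c : LocalRing L v))⁻¹) = E (1 + u * ((c : LocalRing L v))⁻¹) := by
    intro c hc
    have hcU : IsUnit (c : LocalRing L v) := isUnit_of_valued_eq_one L v w hw hc
    have h1 : E (c : LocalRing L v) = 1 := by
      simp only [hEdef, dif_pos hcU]
      have hfixc : χ₁ hcU.unit = 1 := hfix hcU.unit (forall_placesOver_of_apply L v w hw (by rw [IsUnit.unit_spec]; exact hc))
        (by rw [IsUnit.unit_spec]; exact (HeisRing.mem_fixedPart_iff _ _).1 c.2)
      rw [hfixc, inv_one, Units.val_one]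
    rw [h1, one_mul]
  rw [setIntegral_congr_fun hCm hEc]
  -- inversion invariance on `C`
  have hEmeas : Measurable E := by
    have hcont : Continuous fun x : (LocalRing L v)ˣ => (((χ₁ x)⁻¹ : ℂˣ) : ℂ) := by
      have h : (fun x : (LocalRing L v)ˣ => (((χ₁ x)⁻¹ : ℂˣ) : ℂ)) = fun x => (((χ₁ x : ℂˣ) : ℂ))⁻¹ := by
        funext x; rw [Units.val_inv_eq_inv_val]
      rw [h]; exact h₁.inv₀ fun x => Units.ne_zero _
    exact measurable_dite_isUnit L v w hw (fun x => (((χ₁ x)⁻¹ : ℂˣ) : ℂ)) hcont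
  have hg : Measurable fun r : LocalRing L v => E (1 + u * r) := hEmeas.comp (measurable_const.add (measurable_const.mul measurable_id))
  refine setIntegral_fixedUnits_eq_of_forall_eq_inv L v w hw ν (fun r => E (1 + u * r)) (fun r => E (1 + u * r⁻¹)) hg 1 ?_ (fun r _ _ => rfl)
  intro r hr hrv
  -- `|1 + u r|_w = 1`, so the norm of `Ē` there is `≤ 1`
  have hur : Valued.v ((u * r) w) < 1 := by rw [Pi.mul_apply, map_mul, hrv, mul_one]; exact hua
  have hv1 : Valued.v ((1 + u * r) w) = 1 := by rw [Pi.add_apply, Pi.one_apply]; exact Valuation.map_one_add_of_lt _ hur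
  have h := norm_dite_apply_le_one L v w hw χ₁⁻¹ (by
    have h' : (fun x => ((χ₁⁻¹ x : ℂˣ) : ℂ)) = fun x => (((χ₁ x : ℂˣ) : ℂ))⁻¹ := by
      funext x; rw [MonoidHom.inv_apply, Units.val_inv_eq_inv_val]
    rw [h']; exact h₁.inv₀ fun x => Units.ne_zero _) (1 + u * r) hv1
  have hE' : E (1 + u * r) = (if h : IsUnit (1 + u * r) then ((χ₁⁻¹ h.unit : ℂˣ) : ℂ) else 0) := by
    simp only [hEdef, MonoidHom.inv_apply]
  rw [hE']
  exact h

/-! ## §2 The two values: DEEP `Φ(a) = Ē(−δ)·ν(C)`, CRITICAL `Φ(a) = −Ē(−δ)·ν(𝔪⁺)` -/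

include hδv in
omit [IsCMField L] [MeasurableSpace (LocalRing L v)] [BorelSpace (LocalRing L v)] in
/-- `u := −(a·δ⁻¹)` has `|u_w| = |a_w|·exp(1)` (`|δ⁻¹_w| = exp 1`). [folklore] -/
theorem valued_neg_mul_deltaInv_apply (a : LocalRing L v) :
    Valued.v ((-(a * ((δ⁻¹ : (LocalRing L v)ˣ) : LocalRing L v))) w) = Valued.v (a w) * WithZero.exp (1 : ℤ) := by
  have hinv : Valued.v (((δ⁻¹ : (LocalRing L v)ˣ) : LocalRing L v) w) = WithZero.exp (1 : ℤ) := by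
    have hv : WithZero.exp (-1 : ℤ) * Valued.v (((δ⁻¹ : (LocalRing L v)ˣ) : LocalRing L v) w) = 1 := by
      have h := congrArg Valued.v (units_apply_mul_inv_apply L v δ w)
      rwa [map_mul, map_one, hδv] at h
    have h2 := congrArg (fun z => (WithZero.exp (-1 : ℤ))⁻¹ * z) hv
    simp only [← mul_assoc, inv_mul_cancel₀ (WithZero.exp_ne_zero : WithZero.exp (-1 : ℤ) ≠ 0), one_mul, mul_one] at h2
    rw [h2, ← WithZero.exp_neg, neg_neg]
  rw [Pi.neg_apply, Valuation.map_neg, Pi.mul_apply, map_mul, hinv]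

open scoped Classical in
include hw hδv in
/-- **DEEP LEVELS: `Φ(a) = Ē(−δ)·ν(C)`** for `|a_w| ≤ |ϖ|^(m+2)` when `χ₁` is trivial at level `|ϖ|^(m+1)` (`htriv`, the conductor) and on the `σ`-fixed units of valuation one (`hfix`):
`|u_w| ≤ |ϖ|^(m+1)`, so on `C` the integrand `Ē(1 + uc)` is `1` (PART 1 `diteInv_one_add_eq_one_of_le`) and `∫_C 1 dν = ν(C)` after §1.  (PAPER P-ram-1 §2 (R-a), deep: `T = 1 − q⁻¹` per
unit mass.) [cite: Keys1984, §4, §7 Theorem (2) p. 126] -/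
theorem sphere_diteInv_sub_eq_of_fix_deep (h₁ : Continuous fun x => ((χ₁ x : ℂˣ) : ℂ))
    (hfix : ∀ u : (LocalRing L v)ˣ, (∀ w' : PlacesOver L v, Valued.v ((u : LocalRing L v) w') = 1) →
      conjLocal L (IsCMField.complexConj L) v (u : LocalRing L v) = u → χ₁ u = 1)
    {ϖ : w.1.adicCompletion L} (hϖ : Valued.v ϖ = WithZero.exp (-1 : ℤ)) {m : ℕ}
    (htriv : ∀ u : (LocalRing L v)ˣ, Valued.v (((u : LocalRing L v) - 1) w) ≤ Valued.v ϖ ^ (m + 1) → χ₁ u = 1)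
    {a : LocalRing L v} (hav : Valued.v (a w) ≤ Valued.v ϖ ^ (m + 2)) :
    ∫ s in {s : ↥(HeisRing.skewPart (conjLocal L (IsCMField.complexConj L) v)) | Valued.v ((s : LocalRing L v) w) = WithZero.exp (-1 : ℤ)},
        (fun r : LocalRing L v => if h : IsUnit r then (((χ₁ h.unit)⁻¹ : ℂˣ) : ℂ) else 0) (a - (s : LocalRing L v)) ∂μY =
      (((χ₁ (-δ))⁻¹ : ℂˣ) : ℂ) *
        ((μY.map (HeisRing.mulSkewUnit (conjLocal L (IsCMField.complexConj L) v) δ hδ).symm).real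
          {c : ↥(HeisRing.fixedPart (conjLocal L (IsCMField.complexConj L) v)) | Valued.v ((c : LocalRing L v) w) = 1} : ℂ) := by
  have hϖ0 : Valued.v ϖ ≠ 0 := by rw [hϖ]; exact WithZero.exp_ne_zero
  have hϖ1 : Valued.v ϖ < 1 := by rw [hϖ, ← WithZero.exp_zero, WithZero.exp_lt_exp]; norm_num
  -- `|u_w| = |a_w|·e ≤ |ϖ|^(m+2)·|ϖ|⁻¹ = |ϖ|^(m+1)`: on `C`, `1 + uc` is below the conductor, so `Ē(1 + uc) = 1`
  have hu : Valued.v ((-(a * ((δ⁻¹ : (LocalRing L v)ˣ) : LocalRing L v))) w) ≤ Valued.v ϖ ^ (m + 1) := by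
    rw [valued_neg_mul_deltaInv_apply L v w δ hδv a]
    have h1 : WithZero.exp (1 : ℤ) = (Valued.v ϖ)⁻¹ := by rw [hϖ, ← WithZero.exp_neg, neg_neg]
    rw [h1]
    calc Valued.v (a w) * (Valued.v ϖ)⁻¹ ≤ Valued.v ϖ ^ (m + 2) * (Valued.v ϖ)⁻¹ := mul_le_mul_left hav _
      _ = Valued.v ϖ ^ (m + 1) := by rw [pow_succ, mul_assoc, mul_inv_cancel₀ hϖ0, mul_one]
  have hr1 : Valued.v ϖ ^ (m + 1) < 1 := (pow_lt_one_iff (by omega)).2 hϖ1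
  have hu1 : Valued.v ((-(a * ((δ⁻¹ : (LocalRing L v)ˣ) : LocalRing L v))) w) < 1 := lt_of_le_of_lt hu hr1
  rw [setIntegral_sphere_diteInv_sub_eq_fixedUnits_of_fix L v w hw μY χ₁ δ hδ hδv h₁ hfix a hu1]
  congr 1
  have hCm : MeasurableSet {c : ↥(HeisRing.fixedPart (conjLocal L (IsCMField.complexConj L) v)) | Valued.v ((c : LocalRing L v) w) = 1} :=
    (measurableSet_fixedUnits L v w).1
  have hone : ∀ c ∈ {c : ↥(HeisRing.fixedPart (conjLocal L (IsCMField.complexConj L) v)) | Valued.v ((c : LocalRing L v) w) = 1},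
      (fun r : LocalRing L v => if h : IsUnit r then (((χ₁ h.unit)⁻¹ : ℂˣ) : ℂ) else 0)
        (1 + -(a * ((δ⁻¹ : (LocalRing L v)ˣ) : LocalRing L v)) * (c : LocalRing L v)) = 1 := fun c hc =>
    diteInv_one_add_eq_one_of_le L v w hw χ₁ hr1 htriv (by rw [Pi.mul_apply, map_mul, hc, mul_one]; exact hu)
  rw [setIntegral_congr_fun hCm hone, setIntegral_const, Complex.real_smul, mul_one]

open scoped Classical in
include hw hδv in
/-- **CRITICAL LEVEL: `Φ(a) = −Ē(−δ)·ν(𝔪⁺)`** for a `σ`-FIXED `a` with `|a_w| = |ϖ|^(m+1)` (`n = cond χ₁ = m + 1`: conductor letter `hcond` at `|ϖ|^(m+1)`, sharp witness `u₁` at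
`|ϖ|^m`), `χ₁` continuous and trivial on the `σ`-fixed units of valuation one (`hfix` ⟹ `hfixP`): `u := −aδ⁻¹` is SKEW with `|u_w| = |ϖ|^m`, so after §1 PART 2
`setIntegral_fixedUnits_diteInv_inner_eq_neg` (at `f := 1`) gives `∫_C Ē(1 + uc) dν = −ν(𝔪⁺)`.  (PAPER P-ram-1 §2 (R-a), critical: `T = −q⁻¹` per unit mass.)
[cite: Keys1984, §4–§5, §7 Theorem (2) p. 126] [cite: WeilBNT1967, Ch. II §5] -/
theorem sphere_diteInv_sub_eq_of_fix_crit (he : v.asIdeal.ramificationIdx' w.1.asIdeal ≠ 1) (h2w : Valued.v (2 : w.1.adicCompletion L) = 1)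
    (h₁ : Continuous fun x => ((χ₁ x : ℂˣ) : ℂ))
    (hfix : ∀ u : (LocalRing L v)ˣ, (∀ w' : PlacesOver L v, Valued.v ((u : LocalRing L v) w') = 1) →
      conjLocal L (IsCMField.complexConj L) v (u : LocalRing L v) = u → χ₁ u = 1)
    {ϖ : w.1.adicCompletion L} (hϖ : Valued.v ϖ = WithZero.exp (-1 : ℤ)) {m : ℕ} (hm : 1 ≤ m)
    (hcond : ∀ u : (LocalRing L v)ˣ, (∀ w' : PlacesOver L v, Valued.v (((u : LocalRing L v) w') - 1) ≤ Valued.v ϖ ^ (m + 1)) → χ₁ u = 1)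
    (u₁ : (LocalRing L v)ˣ) (hu₁ : ∀ w' : PlacesOver L v, Valued.v (((u₁ : LocalRing L v) w') - 1) ≤ Valued.v ϖ ^ m) (hχu₁ : χ₁ u₁ ≠ 1)
    {a : LocalRing L v} (ha : conjLocal L (IsCMField.complexConj L) v a = a) (hav : Valued.v (a w) = Valued.v ϖ ^ (m + 1)) :
    ∫ s in {s : ↥(HeisRing.skewPart (conjLocal L (IsCMField.complexConj L) v)) | Valued.v ((s : LocalRing L v) w) = WithZero.exp (-1 : ℤ)},
        (fun r : LocalRing L v => if h : IsUnit r then (((χ₁ h.unit)⁻¹ : ℂˣ) : ℂ) else 0) (a - (s : LocalRing L v)) ∂μY =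
      -((((χ₁ (-δ))⁻¹ : ℂˣ) : ℂ) *
        ((μY.map (HeisRing.mulSkewUnit (conjLocal L (IsCMField.complexConj L) v) δ hδ).symm).real
          {c : ↥(HeisRing.fixedPart (conjLocal L (IsCMField.complexConj L) v)) | Valued.v ((c : LocalRing L v) w) < 1} : ℂ)) := by
  have hϖ0 : Valued.v ϖ ≠ 0 := by rw [hϖ]; exact WithZero.exp_ne_zero
  have hϖ1 : Valued.v ϖ < 1 := by rw [hϖ, ← WithZero.exp_zero, WithZero.exp_lt_exp]; norm_num
  -- `u` is skew of valuation `|ϖ|^m`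
  have hδinv : conjLocal L (IsCMField.complexConj L) v (((δ⁻¹ : (LocalRing L v)ˣ)) : LocalRing L v) = -(((δ⁻¹ : (LocalRing L v)ˣ)) : LocalRing L v) := by
    have h := congrArg (conjLocal L (IsCMField.complexConj L) v) (δ.inv_mul)
    rw [map_mul, map_one, hδ, mul_neg] at h
    have h1 : conjLocal L (IsCMField.complexConj L) v (((δ⁻¹ : (LocalRing L v)ˣ)) : LocalRing L v) * (δ : LocalRing L v) = -1 := by
      linear_combination (-1 : LocalRing L v) * h
    calc conjLocal L (IsCMField.complexConj L) v (((δ⁻¹ : (LocalRing L v)ˣ)) : LocalRing L v)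
        = conjLocal L (IsCMField.complexConj L) v (((δ⁻¹ : (LocalRing L v)ˣ)) : LocalRing L v) * ((δ : LocalRing L v) * ((δ⁻¹ : (LocalRing L v)ˣ) : LocalRing L v)) := by
          rw [Units.mul_inv, mul_one]
      _ = -(((δ⁻¹ : (LocalRing L v)ˣ)) : LocalRing L v) := by rw [← mul_assoc, h1, neg_one_mul]
  have huσ : conjLocal L (IsCMField.complexConj L) v (-(a * ((δ⁻¹ : (LocalRing L v)ˣ) : LocalRing L v))) = -(-(a * ((δ⁻¹ : (LocalRing L v)ˣ) : LocalRing L v))) := by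
    rw [map_neg, map_mul, ha, hδinv, mul_neg]
  have huv : Valued.v ((-(a * ((δ⁻¹ : (LocalRing L v)ˣ) : LocalRing L v))) w) = Valued.v ϖ ^ m := by
    rw [valued_neg_mul_deltaInv_apply L v w δ hδv a, hav, show WithZero.exp (1 : ℤ) = (Valued.v ϖ)⁻¹ by rw [hϖ, ← WithZero.exp_neg, neg_neg],
      pow_succ, mul_assoc, mul_inv_cancel₀ hϖ0, mul_one]
  have hu1 : Valued.v ((-(a * ((δ⁻¹ : (LocalRing L v)ˣ) : LocalRing L v))) w) < 1 := by
    rw [huv]; exact (pow_lt_one_iff (by omega)).2 hϖ1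
  have hfixP : ∀ u : (LocalRing L v)ˣ, (∀ w' : PlacesOver L v, Valued.v (((u : LocalRing L v) w') - 1) < 1) →
      conjLocal L (IsCMField.complexConj L) v (u : LocalRing L v) = u → χ₁ u = 1 := fun u hu hσu =>
    hfix u (fun w' => by
      have e : (u : LocalRing L v) w' = 1 + ((u : LocalRing L v) w' - 1) := by ring
      rw [e]; exact Valuation.map_one_add_of_lt _ (hu w')) hσu
  rw [setIntegral_sphere_diteInv_sub_eq_fixedUnits_of_fix L v w hw μY χ₁ δ hδ hδv h₁ hfix a hu1]
  have hinner := setIntegral_fixedUnits_diteInv_inner_eq_neg L v w hw μY χ₁ δ hδ he h2w h₁ hfixP hϖ hm hcond u₁ hu₁ hχu₁ huσ huv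
    (f := (1 : LocalRing L v)) (map_one _) (by rw [Pi.one_apply, map_one])
  simp only [mul_one] at hinner
  rw [hinner, mul_neg]

/-! ## §3 The mass ratio `ν(C) = (N𝔭_w − 1)·ν(𝔪⁺)` and the (R-a) RATIO -/

include hw hδv in
/-- **`ν(C) = (N𝔭_w − 1)·ν(𝔪⁺)`** for `ν = μ⁻.map M⁻¹` (`M c = δc`, `|δ_w| = e⁻¹`) at a tame RAMIFIED place: `ν(C) = μ⁻{|y_w| = e⁻¹}` and `ν(𝔪⁺) = μ⁻{|y_w| < e⁻¹} = μ⁻{|y_w| ≤ e⁻²}`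
(★ `measurePreserving_mulSkewUnit`, ★ `preimage_mulSkewUnit_setOf_valued`); skew valuations are odd, so `{|y_w| ≤ 1} = {|y_w| = e⁻¹} ⊔ {|y_w| ≤ e⁻²}` (★
`setOf_skew_valued_eq_one_eq_empty_of_ramified`) and `μ⁻{|y_w| ≤ e⁻²} = (N𝔭_v)⁻¹μ⁻{|y_w| ≤ 1}` (★ `measure_setOf_skew_valued_le_exp_neg_two_of_ramified`), `N𝔭_w = N𝔭_v`
(★ `absNorm_placesOver_eq_of_ramified`). [cite: Rogawski1990, §12.2 (2) p. 173] [cite: WeilBNT1967, Ch. I §2] -/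
theorem measureReal_fixedUnits_eq_mul_of_ramified (he : v.asIdeal.ramificationIdx' w.1.asIdeal ≠ 1) (h2w : Valued.v (2 : w.1.adicCompletion L) = 1) :
    (μY.map (HeisRing.mulSkewUnit (conjLocal L (IsCMField.complexConj L) v) δ hδ).symm).real
        {c : ↥(HeisRing.fixedPart (conjLocal L (IsCMField.complexConj L) v)) | Valued.v ((c : LocalRing L v) w) = 1} =
      ((Ideal.absNorm w.1.asIdeal : ℝ) - 1) *
        (μY.map (HeisRing.mulSkewUnit (conjLocal L (IsCMField.complexConj L) v) δ hδ).symm).real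
          {c : ↥(HeisRing.fixedPart (conjLocal L (IsCMField.complexConj L) v)) | Valued.v ((c : LocalRing L v) w) < 1} := by
  set M := HeisRing.mulSkewUnit (conjLocal L (IsCMField.complexConj L) v) δ hδ with hM
  have hpres := measurePreserving_mulSkewUnit L v μY δ hδ
  have hδ0 : Valued.v ((δ : LocalRing L v) w) ≠ 0 := by rw [hδv]; exact WithZero.exp_ne_zero
  -- the two preimages
  have hC : {c : ↥(HeisRing.fixedPart (conjLocal L (IsCMField.complexConj L) v)) | Valued.v ((c : LocalRing L v) w) = 1} =
      M ⁻¹' {s : ↥(HeisRing.skewPart (conjLocal L (IsCMField.complexConj L) v)) | Valued.v ((s : LocalRing L v) w) ∈ ({WithZero.exp (-1 : ℤ)} : Set _)} := by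
    rw [hM, preimage_mulSkewUnit_setOf_valued L v w δ hδ, hδv]
    ext c
    simp only [Set.mem_setOf_eq, Set.mem_singleton_iff]
    constructor
    · intro h; rw [h, mul_one]
    · intro h
      exact mul_left_cancel₀ (WithZero.exp_ne_zero : WithZero.exp (-1 : ℤ) ≠ 0) (h.trans (mul_one _).symm)
  have hm : {c : ↥(HeisRing.fixedPart (conjLocal L (IsCMField.complexConj L) v)) | Valued.v ((c : LocalRing L v) w) < 1} =
      M ⁻¹' {s : ↥(HeisRing.skewPart (conjLocal L (IsCMField.complexConj L) v)) | Valued.v ((s : LocalRing L v) w) ∈ Set.Iio (WithZero.exp (-1 : ℤ))} := by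
    rw [hM, preimage_mulSkewUnit_setOf_valued L v w δ hδ, hδv]
    ext c
    simp only [Set.mem_setOf_eq, Set.mem_Iio]
    rcases eq_or_ne ((c : LocalRing L v) w) 0 with h0 | h0
    · rw [h0, map_zero, mul_zero]; exact ⟨fun _ => WithZero.exp_pos, fun _ => zero_lt_one⟩
    · obtain ⟨l, hl⟩ : ∃ l : ℤ, Valued.v ((c : LocalRing L v) w) = WithZero.exp l := ⟨_, (WithZero.exp_log ((Valuation.ne_zero_iff _).2 h0)).symm⟩
      rw [hl, ← WithZero.exp_add, WithZero.exp_lt_exp, ← WithZero.exp_zero, WithZero.exp_lt_exp]; omega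
  -- skew sets: `{= e⁻¹} = {≤ 1} \\ {≤ e⁻²}`, `{< e⁻¹} = {≤ e⁻²}`
  set B : Set ↥(HeisRing.skewPart (conjLocal L (IsCMField.complexConj L) v)) := {y | Valued.v ((y : LocalRing L v) w) ≤ 1} with hBdef
  set B2 : Set ↥(HeisRing.skewPart (conjLocal L (IsCMField.complexConj L) v)) := {y | Valued.v ((y : LocalRing L v) w) ≤ WithZero.exp (-2 : ℤ)} with hB2def
  have hlt : {s : ↥(HeisRing.skewPart (conjLocal L (IsCMField.complexConj L) v)) | Valued.v ((s : LocalRing L v) w) ∈ Set.Iio (WithZero.exp (-1 : ℤ))} = B2 := by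
    ext s
    simp only [Set.mem_setOf_eq, Set.mem_Iio, hB2def]
    rcases eq_or_ne ((s : LocalRing L v) w) 0 with h0 | h0
    · rw [h0, map_zero]; exact ⟨fun _ => zero_le, fun _ => WithZero.exp_pos⟩
    · obtain ⟨l, hl⟩ : ∃ l : ℤ, Valued.v ((s : LocalRing L v) w) = WithZero.exp l := ⟨_, (WithZero.exp_log ((Valuation.ne_zero_iff _).2 h0)).symm⟩
      rw [hl, WithZero.exp_lt_exp, WithZero.exp_le_exp]; omega
  have heq : {s : ↥(HeisRing.skewPart (conjLocal L (IsCMField.complexConj L) v)) | Valued.v ((s : LocalRing L v) w) ∈ ({WithZero.exp (-1 : ℤ)} : Set _)} = B \ B2 := by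
    ext s
    simp only [Set.mem_setOf_eq, Set.mem_singleton_iff, Set.mem_sdiff, hBdef, hB2def, not_le]
    constructor
    · intro h; rw [h]; exact ⟨by rw [← WithZero.exp_zero, WithZero.exp_le_exp]; norm_num, WithZero.exp_lt_exp.2 (by norm_num)⟩
    · rintro ⟨h1, h2⟩
      have hne1 : Valued.v ((s : LocalRing L v) w) ≠ 1 := fun h1' =>
        (Set.eq_empty_iff_forall_notMem.1 (setOf_skew_valued_eq_one_eq_empty_of_ramified L v w hw he h2w)) s h1'
      rcases eq_or_ne ((s : LocalRing L v) w) 0 with h0 | h0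
      · rw [h0, map_zero] at h2; exact absurd h2 (not_lt.2 zero_le)
      · obtain ⟨l, hl⟩ : ∃ l : ℤ, Valued.v ((s : LocalRing L v) w) = WithZero.exp l := ⟨_, (WithZero.exp_log ((Valuation.ne_zero_iff _).2 h0)).symm⟩
        rw [hl] at h1 h2 hne1 ⊢
        rw [← WithZero.exp_zero, WithZero.exp_le_exp] at h1
        rw [WithZero.exp_lt_exp] at h2
        rw [← WithZero.exp_zero, Ne, WithZero.exp_injective.eq_iff] at hne1
        congr 1; omega
  have hBm : MeasurableSet B := ((isClosed_setOf_valued_apply_le_one L v w).preimage continuous_subtype_val).measurableSet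
  have hB2m : MeasurableSet B2 := ((isCompact_setOf_valued_le_exp_any L v w hw (-2)).isClosed.preimage continuous_subtype_val).measurableSet
  have hB2B : B2 ⊆ B := fun s (hs : Valued.v ((s : LocalRing L v) w) ≤ WithZero.exp (-2 : ℤ)) =>
    hs.trans (by rw [← WithZero.exp_zero, WithZero.exp_le_exp]; norm_num)
  have hBfin : μY B ≠ ⊤ := by
    have hc : IsCompact B := (HeisRing.isClosed_skewPart _ (continuous_conjLocal L (IsCMField.complexConj L) v)).isClosedEmbedding_subtypeVal.isCompact_preimage
      (isCompact_setOf_valued_apply_le_one L v w hw)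
    exact hc.measure_lt_top.ne
  -- ratio on `R⁻`
  have hratio : μY.real B2 = ((Ideal.absNorm w.1.asIdeal : ℝ))⁻¹ * μY.real B := by
    rw [measureReal_def, hB2def, measure_setOf_skew_valued_le_exp_neg_two_of_ramified L v w hw μY he, ← Rogawski1990.absNorm_placesOver_eq_of_ramified L v w hw he,
      ENNReal.smul_def, smul_eq_mul, ENNReal.toReal_mul, ENNReal.coe_toReal, NNReal.coe_inv, NNReal.coe_natCast, measureReal_def]
  have hq : (Ideal.absNorm w.1.asIdeal : ℝ) ≠ 0 := Nat.cast_ne_zero.2 fun h => w.1.ne_bot (Ideal.absNorm_eq_zero_iff.1 h)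
  rw [hC, hm, heq, hlt, measureReal_def, measureReal_def, hpres.measure_preimage (hBm.diff hB2m).nullMeasurableSet, hpres.measure_preimage hB2m.nullMeasurableSet,
    ← measureReal_def, ← measureReal_def, measureReal_sdiff hB2B hB2m hBfin, hratio]
  field_simp

/-- **THE (R-a) RATIO — `Φdeep + Φcrit·(N𝔭_w − 1) = 0`** for the two values of §2 (`Φdeep = Ē(−δ)ν(C)`, `Φcrit = −Ē(−δ)ν(𝔪⁺)`, §3): the letter `hAB` of ★ p864421
`setIntegral_oddShell_cutoff_eq_zero_of_fibre_ratio` after the (6e) rows scale both by the same factor. [cite: Keys1984, §7 Theorem (2) p. 126] -/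
theorem sphere_fix_ratio {E νC νm Q : ℂ} (hC : νC = (Q - 1) * νm) {Φdeep Φcrit : ℂ} (hdeep : Φdeep = E * νC) (hcrit : Φcrit = -(E * νm)) (K : ℂ) :
    K * Φdeep + K * Φcrit * (Q - 1) = 0 := by
  rw [hdeep, hcrit, hC]; ring

end Summit.HodgeConjecture.HodgeConjecture.R90.S1.BposRamSphereFibreRa

end
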